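import Literature.AnabelianGeometry.AbsoluteAnabelian.NFGaloisTFGNormalProofs
import Literature.AnabelianGeometry.AbsoluteAnabelian.AbsAnabFundamentalGroupsProofs
import Literature.AnabelianGeometry.AbsoluteAnabelian.AbsTopISemiAbsoluteProofs
import Literature.AnabelianGeometry.AbsoluteAnabelian.AbsTopII.Remark332Proofs
import HarnessLib

/-!
# Consequences of [AbsAnab] Thm 1.1.2 made unconditional

With `galoisNF_tfgNormalSubgroup_trivial_holds` ([AbsAnab] Thm 1.1.2, file
`NFGaloisTFGNormalProofs.lean`) the printed deductions already kernel-checked in the tree RELATIVE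
to that named fact become unconditional theorems:

* `FundamentalExtension.geomIsMaxTFGNormalIn_of_nfBase` and `FundamentalExtension.lemma114_i_holds`
  — [AbsAnab] Lemma 1.1.4 (i) (A. Tamagawa; "a formal consequence of Theorem 1.1.2"), from
  abc-iut-L4-d3/t4's `geomIsMaxTFGNormalIn_of_tfgNormalSubgroup_trivial` /
  `lemma114_i_of_tfgNormalSubgroup_trivial` (`AbsAnabFundamentalGroupsProofs.lean`);
* `FundamentalExtension.thm26_vi_maximal_holds` — [AbsTopI] Thm 2.6 (vi), the clause "`Δ` is the
  maximal topologically finitely generated closed normal subgroup of `Π`" for `k` an NF, from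
  abc-iut-L4-t4's `thm26_vi_maximal_of_tfgNormalSubgroup_trivial` (`AbsTopISemiAbsoluteProofs.lean`);
* `AbsTopII.rmk_3_3_2_NF_holds` — [AbsTopII] Rmk 3.3.2 ("`Δ` may be characterized as the maximal
  topologically finitely generated closed normal subgroup of `Π`; any isomorphism preserves `Δ`")
  on the class of all extensions with NF base and topologically finitely generated `Δ`, from
  `AbsTopII.rmk_3_3_2_NF_of_tfgNormalSubgroup_trivial` (`AbsTopII/Remark332Proofs.lean`).

Nothing here is specific to, or takes a side on, the disputed corpus ([IUTchI–IV]); typed ≠ proved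
applies only upstream of these theorems, which are proved. [cite: MochizukiAbsAnab2004, Thm 1.1.2 p.6]
-/

noncomputable section

namespace Literature.AnabelianGeometry.AbsoluteAnabelian

namespace FundamentalExtension

/-- **[AbsAnab] Lemma 1.1.4 (i), unconditional** (case of an arbitrary open `Π′ ⊆ Π`): for every
extension `1 → Δ → Π → G_F → 1` with `F` a number field and `Δ` topologically finitely generated,
and every open subgroup `Π′ ⊆ Π`, `Δ ∩ Π′` is the unique maximal topologically finitely generated
closed normal subgroup of `Π′`. [cite: MochizukiAbsAnab2004, Lemma 1.1.4 (i) p.7] -/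
theorem geomIsMaxTFGNormalIn_of_nfBase (E : FundamentalExtension.{0}) (B : E.NFBase)
    (hΔ : IsTopologicallyFinitelyGenerated E.geom) (P : Subgroup E.arith)
    (hP : IsOpen (P : Set E.arith)) : E.GeomIsMaxTFGNormalIn P :=
  geomIsMaxTFGNormalIn_of_tfgNormalSubgroup_trivial galoisNF_tfgNormalSubgroup_trivial_holds E B hΔ P hP

/-- **[AbsAnab] Lemma 1.1.4 (i) — the named fact `lemma114_i` DISCHARGED** (Thm 1.1.2 is now the
theorem `galoisNF_tfgNormalSubgroup_trivial_holds`). [cite: MochizukiAbsAnab2004, Lemma 1.1.4 (i) p.7] -/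
theorem lemma114_i_holds :
    Literature.AnabelianGeometry.AbsoluteAnabelian.FundamentalExtension.lemma114_i :=
  lemma114_i_of_tfgNormalSubgroup_trivial galoisNF_tfgNormalSubgroup_trivial_holds

/-- **[AbsTopI] Thm 2.6 (vi), maximality clause — the named fact `thm26_vi_maximal` DISCHARGED**:
for every extension `1 → Δ → Π → G_F → 1` (`F` a number field) with `Δ` topologically finitely
generated, `Δ` is the maximal topologically finitely generated closed normal subgroup of `Π`.
[cite: MochizukiAbsTopI2012, Thm 2.6 (vi) p.22] -/
theorem thm26_vi_maximal_holds :
    Literature.AnabelianGeometry.AbsoluteAnabelian.FundamentalExtension.thm26_vi_maximal :=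
  thm26_vi_maximal_of_tfgNormalSubgroup_trivial galoisNF_tfgNormalSubgroup_trivial_holds

end FundamentalExtension

namespace AbsTopII

/-- **[AbsTopII] Rmk 3.3.2 for NF bases, unconditional**: on the class of all extensions
`1 → Δ → Π → G → 1` with `G ≅ G_F` (`F` a number field) and `Δ` topologically finitely generated,
every bicontinuous isomorphism `Π_E ≃ Π_F` carries `Δ_E` onto `Δ_F`.
[cite: MochizukiAbsTopII2013, Rmk 3.3.2 p.69] -/
theorem rmk_3_3_2_NF_holds :
    Rmk_3_3_2 {E : FundamentalExtension.{0} |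
      Nonempty E.NFBase ∧ IsTopologicallyFinitelyGenerated E.geom} :=
  rmk_3_3_2_NF_of_tfgNormalSubgroup_trivial galoisNF_tfgNormalSubgroup_trivial_holds

end AbsTopII

end Literature.AnabelianGeometry.AbsoluteAnabelian
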